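import Mathlib
import HarnessLib

/-!
# Chen's theorem: the weighted-sieve inequality (Nathanson, Theorem 10.2), abstract form

Trunk T-SIEVE, family `parity` (parity.S12: `Literature.NumberTheory.Sieve.chen_twin`, `Literature.NumberTheory.Sieve.chen_goldbach`).
This file PROVES the elementary combinatorial step of Chen's proof — the passage from the number of
`P₂`'s in a finite set of integers to three sieving functions — in an abstract form that serves both
the Goldbach sequence `{N − p}` and the twin sequence `{p + 2}`.

## Sources

* M. B. Nathanson, *Additive Number Theory: The Classical Bases*, GTM 164, Springer (1996), §10.2,
  pp. 271–275, Theorem 10.2 [Nathanson1996]: with `z = N^{1/8}`, `y = N^{1/3}` and the weight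
  `w(n) = 1 − ½ ∑_{z ≤ q < y, q^k ∥ n} k − ½ ∑_{n = p₁p₂p₃, z ≤ p₁ < y ≤ p₂ ≤ p₃} 1` ((10.5)),
  `r(N) > S(A, 𝒫, z) − ½ ∑_{z ≤ q < y} S(A_q, 𝒫, z) − ½ S(B, 𝒫, y) − 2N^{7/8} − N^{1/3}`.
* Chen Jing-run, Sci. Sinica 16 (1973) 157–176, §III, (34) (W p. 168 of the reprint in Wang Yuan
  (ed.), *Goldbach Conjecture*, World Scientific 1984): the same inequality with `z = x^{1/10}`,
  `y = x^{1/3}` ("It is obvious that `P_x(1,2) ≥ P_x(x, x^{1/10}) − ½ ∑ P_x(x, p, x^{1/10}) − ½ Ω −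
  …`"). [ChenSciSinica1973]

## What is proved

For a finite set `A` of positive integers `< y³` and integer parameters `z, y`
(`Literature.NumberTheory.Sieve.ChenSieve.weightedSieve`):

  `S(A, z) − ½ ∑_{z ≤ q < y, q prime} S(A_q, z) − ½ T(A; z, y) − E(A; z, y) ≤ #{n ∈ A : Ω(n) ≤ 2}`,

where `S(A, z) = #{n ∈ A : n has no prime factor < z}` (`roughCount`), `S(A_q, z)` is the same count
restricted to the multiples of `q` (`roughMultCount`), `T(A; z, y) = #{n ∈ A : n = p₁p₂p₃,
z ≤ p₁ < y ≤ p₂ ≤ p₃}` (`tripleCount`; for `A = {N − p}` these `n` are the primes of Nathanson's set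
`B`, for `A = {p + 2}` those of `{p₁p₂p₃ − 2}`) and `E(A; z, y) = #{n ∈ A : q² ∣ n for some prime
z ≤ q < y}` (`squareCount`), together with the bound `E ≤ M/(z − 1)` when `A ⊆ (0, M]` and `z ≥ 2`
(`squareCount_le`; Nathanson's `2N^{7/8}`).

Proof (Nathanson pp. 271–272, pointwise form `weight_le_indicator`): let `n ∈ A` have all its prime
factors `≥ z` and no square of a prime of `[z, y)` dividing it; write `r` for the number of its prime
factors in `[z, y)` and `s` for the number (with multiplicity) of those `≥ y`. Then `Ω(n) = r + s` and
`y^s ≤ n < y³` gives `s ≤ 2`; so if `Ω(n) ≥ 3` then `r ≥ 1`, and either `r ≥ 2` (weight `≤ 0`) or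
`r = 1, s = 2`, i.e. `n = p₁p₂p₃` with `z ≤ p₁ < y ≤ p₂ ≤ p₃` (weight `1 − ½ − ½ = 0`). Hence
`1 − ½ r − ½·1[n = p₁p₂p₃] − 1[∃ q, q² ∣ n] ≤ 1[Ω(n) ≤ 2]` for every `z`-rough `n ∈ A`; summing over
such `n` and interchanging the double sum `∑_n r(n) = ∑_q S(A_q, z)` gives the inequality.

Differences from the printed statement (all on the safe side): Nathanson counts the prime factors
in `[z, y)` with multiplicity and bounds the excess over the squarefree count by `2N^{7/8}`; here the
integers divisible by some `q²`, `z ≤ q < y`, are discarded outright (the term `E`, bounded by the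
same `M ∑_{q ≥ z} q^{-2} ≤ M/(z − 1)`), which is the form used by Halberstam–Richert, Ch. 11. The
sifting set `𝒫` does not appear: in both applications every element of `A` is coprime to the
excluded primes (`2`, resp. the primes dividing `N`), so "no prime factor `< z`" is Nathanson's
`(n, P(z)) = 1`. The hypotheses `z ≤ y`, `z ≥ 2` are not needed for the inequality itself.

## Mathlib

Uses `Nat.primeFactorsList` (as a multiset: product, cardinality `= Ω`, `Multiset.filter_add_not`),
`ArithmeticFunction.cardFactors`, `Nat.IsAtMostAlmostPrime`, `Nat.Ioc_filter_dvd_card_eq_div`.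
No sieve-theoretic input. Mathlib has no weighted sieve (searched `almostPrime`, `cardFactors`,
`sieve`: only `Mathlib.NumberTheory.SelbergSieve` upper-bound material).
-/

open Finset
open scoped ArithmeticFunction.Omega

namespace Literature.NumberTheory.Sieve

namespace ChenSieve

/-! ### The counting functions -/

/-- `IsRough z n`: every prime factor of `n` is `≥ z` (for `n ≥ 1`: `(n, P(z)) = 1` with
`P(z) = ∏_{p < z} p`). [folklore] -/
def IsRough (z n : ℕ) : Prop :=
  ∀ p ∈ n.primeFactors, z ≤ p

/-- `IsRough z n` is decidable (a bounded quantifier over `n.primeFactors`). [folklore] -/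
instance (z n : ℕ) : Decidable (IsRough z n) := by
  unfold IsRough; infer_instance

/-- `IsChenTriple z y n`: `n = p₁ p₂ p₃` with primes `z ≤ p₁ < y ≤ p₂ ≤ p₃` (the integers counted
by the third weight in Nathanson (10.5); `N − n`, resp. `n − 2`, ranges over his set `B`).
[cite: Nathanson1996, (10.5)] -/
def IsChenTriple (z y n : ℕ) : Prop :=
  ∃ p₁ p₂ p₃ : ℕ, p₁.Prime ∧ p₂.Prime ∧ p₃.Prime ∧ z ≤ p₁ ∧ p₁ < y ∧ y ≤ p₂ ∧ p₂ ≤ p₃ ∧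
    n = p₁ * p₂ * p₃

/-- `HasPrimeSqFactor z y n`: some prime `q` with `z ≤ q < y` has `q² ∣ n` (the non-squarefree part
discarded into the error term). [folklore] -/
def HasPrimeSqFactor (z y n : ℕ) : Prop :=
  ∃ q : ℕ, q.Prime ∧ z ≤ q ∧ q < y ∧ q ^ 2 ∣ n

/-- The primes `q` with `z ≤ q < y`. [folklore] -/
def primesIco (z y : ℕ) : Finset ℕ :=
  (Finset.Ico z y).filter Nat.Prime

variable (A : Finset ℕ) (z y : ℕ)

/-- `S(A, z) = #{n ∈ A : n has no prime factor < z}` (Nathanson's `S(A, 𝒫, z)` when the elements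
of `A` are coprime to the non-sifting primes). [cite: Nathanson1996, §10.2] -/
def roughCount : ℕ :=
  #(A.filter fun n => IsRough z n)

/-- `S(A_q, z) = #{n ∈ A : q ∣ n, n has no prime factor < z}`. [cite: Nathanson1996, §10.2] -/
def roughMultCount (q : ℕ) : ℕ :=
  #(A.filter fun n => q ∣ n ∧ IsRough z n)

open scoped Classical in
/-- `T(A; z, y) = #{n ∈ A : n = p₁p₂p₃, z ≤ p₁ < y ≤ p₂ ≤ p₃}`. [cite: Nathanson1996, §10.2] -/
noncomputable def tripleCount : ℕ :=
  #(A.filter fun n => IsChenTriple z y n)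

open scoped Classical in
/-- `E(A; z, y) = #{n ∈ A : q² ∣ n for some prime z ≤ q < y}`. [folklore] -/
noncomputable def squareCount : ℕ :=
  #(A.filter fun n => HasPrimeSqFactor z y n)

open scoped Classical in
/-- `#{n ∈ A : Ω(n) ≤ 2, n ≠ 0}` (Mathlib's `Nat.IsAtMostAlmostPrime 2`). [folklore] -/
noncomputable def almostPrimeTwoCount : ℕ :=
  #(A.filter fun n => Nat.IsAtMostAlmostPrime 2 n)

variable {A z y}

/-! ### Unfolding lemmas -/

/-- Unfolding lemma for `IsRough`. [folklore] -/
theorem isRough_iff {z n : ℕ} : IsRough z n ↔ ∀ p ∈ n.primeFactors, z ≤ p := Iff.rfl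

/-- Membership in `primesIco z y`: the primes `q` with `z ≤ q < y`. [folklore] -/
theorem mem_primesIco {z y q : ℕ} : q ∈ primesIco z y ↔ q.Prime ∧ z ≤ q ∧ q < y := by
  simp only [primesIco, Finset.mem_filter, Finset.mem_Ico]
  tauto

/-! ### The pointwise inequality -/

/-- Number of prime factors of `n` in `[z, y)` (without multiplicity; Nathanson's `r`).
[cite: Nathanson1996, §10.2 (proof of Thm 10.2)] -/
def smallFactorCount (z y n : ℕ) : ℕ :=
  #(n.primeFactors.filter fun q => z ≤ q ∧ q < y)

/-- **Pointwise weight inequality** (Nathanson pp. 271–272): for `n ≠ 0`, `n < y³`, all prime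
factors `≥ z` and no `q² ∣ n` with `z ≤ q < y` prime,
`1 − ½ #{q ∣ n : z ≤ q < y} − ½ · 1[n = p₁p₂p₃, z ≤ p₁ < y ≤ p₂ ≤ p₃] ≤ 1[Ω(n) ≤ 2]`.
[cite: Nathanson1996, §10.2 (proof of Thm 10.2)] -/
theorem weight_le_indicator {z y n : ℕ} (hn : n ≠ 0) (hny : n < y ^ 3) (hr : IsRough z n)
    (hsq : ¬ HasPrimeSqFactor z y n) [Decidable (IsChenTriple z y n)]
    [Decidable (Nat.IsAtMostAlmostPrime 2 n)] :
    (1 : ℝ) - (1 / 2) * smallFactorCount z y n - (1 / 2) * (if IsChenTriple z y n then 1 else 0) ≤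
      if Nat.IsAtMostAlmostPrime 2 n then 1 else 0 := by
  -- the multiset of prime factors, split at `y`
  set M : Multiset ℕ := (n.primeFactorsList : Multiset ℕ) with hM
  have hMmem : ∀ p ∈ M, p.Prime ∧ p ∣ n := fun p hp => by
    rw [hM, Multiset.mem_coe, Nat.mem_primeFactorsList hn] at hp; exact hp
  have hMz : ∀ p ∈ M, z ≤ p := fun p hp => by
    refine hr p ?_
    rw [hM, Multiset.mem_coe] at hp
    exact Nat.mem_primeFactors_iff_mem_primeFactorsList.mpr hp
  have hMprod : M.prod = n := by rw [hM, Multiset.prod_coe, Nat.prod_primeFactorsList hn]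
  have hMcard : Ω n = M.card := by
    rw [hM, Multiset.coe_card, ArithmeticFunction.cardFactors_apply]
  set Ms := M.filter (fun p => p < y) with hMs
  set Mb := M.filter (fun p => ¬ p < y) with hMb
  have hsplit : Ms + Mb = M := Multiset.filter_add_not _ M
  have hcard : M.card = Ms.card + Mb.card := by rw [← hsplit, Multiset.card_add]
  have hprod : n = Ms.prod * Mb.prod := by rw [← hMprod, ← hsplit, Multiset.prod_add]
  -- `s ≤ 2`
  have hy : 2 ≤ y := by
    by_contra h
    have : y ^ 3 ≤ 1 := by
      have : y ≤ 1 := by omega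
      calc y ^ 3 ≤ 1 ^ 3 := Nat.pow_le_pow_left this 3
        _ = 1 := one_pow 3
    omega
  have hMb2 : Mb.card ≤ 2 := by
    have h1 : y ^ Mb.card ≤ Mb.prod :=
      Multiset.pow_card_le_prod (fun p hp => by
        rw [hMb, Multiset.mem_filter] at hp; omega)
    have h2 : Mb.prod ≤ n := by
      have : 1 ≤ Ms.prod := Multiset.one_le_prod_of_one_le fun p hp => by
        rw [hMs, Multiset.mem_filter] at hp
        exact (hMmem p hp.1).1.one_lt.le
      calc Mb.prod = 1 * Mb.prod := (one_mul _).symm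
        _ ≤ Ms.prod * Mb.prod := Nat.mul_le_mul_right _ this
        _ = n := hprod.symm
    have h3 : y ^ Mb.card < y ^ 3 := lt_of_le_of_lt (h1.trans h2) hny
    have := (Nat.pow_lt_pow_iff_right (by omega)).mp h3
    omega
  -- `Ms` has no repeated element, so its cardinality is `smallFactorCount`
  have hMsNodup : Ms.Nodup := by
    rw [Multiset.nodup_iff_count_le_one]
    intro q
    by_contra h
    push Not at h
    have hqMs : q ∈ Ms := Multiset.count_pos.mp (by omega)
    have hqM : q ∈ M := Multiset.mem_of_mem_filter hqMs
    have hqy : q < y := (Multiset.mem_filter.mp hqMs).2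
    have hq : q.Prime := (hMmem q hqM).1
    have hcount : 2 ≤ n.factorization q := by
      have h1 : Ms.count q ≤ M.count q := Multiset.count_le_of_le q (Multiset.filter_le _ M)
      have h2 : M.count q = n.factorization q := by
        rw [hM, Multiset.coe_count, Nat.primeFactorsList_count_eq]
      omega
    exact hsq ⟨q, hq, hMz q hqM, hqy, (hq.pow_dvd_iff_le_factorization hn).mpr hcount⟩
  have hMsCard : Ms.card = smallFactorCount z y n := by
    rw [smallFactorCount, ← Multiset.toFinset_card_of_nodup hMsNodup]
    congr 1
    ext q
    rw [Multiset.mem_toFinset, hMs, Multiset.mem_filter, Finset.mem_filter,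
      Nat.mem_primeFactors_iff_mem_primeFactorsList, hM, Multiset.mem_coe]
    constructor
    · rintro ⟨hq, hqy⟩
      exact ⟨hq, hMz q (by rw [hM, Multiset.mem_coe]; exact hq), hqy⟩
    · rintro ⟨hq, -, hqy⟩
      exact ⟨hq, hqy⟩
  -- case analysis on `Ω n`
  have hsfc : (0 : ℝ) ≤ smallFactorCount z y n := Nat.cast_nonneg _
  by_cases hΩ : Ω n ≤ 2
  · have hP : Nat.IsAtMostAlmostPrime 2 n := ⟨hn, hΩ⟩
    rw [if_pos hP]
    split_ifs <;> linarith
  · have hP : ¬ Nat.IsAtMostAlmostPrime 2 n := fun h => hΩ h.2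
    rw [if_neg hP]
    push Not at hΩ
    rw [hMcard, hcard] at hΩ
    by_cases hr2 : 2 ≤ Ms.card
    · have : (2 : ℝ) ≤ smallFactorCount z y n := by rw [← hMsCard]; exact_mod_cast hr2
      split_ifs <;> linarith
    · -- `r = 1`, `s = 2`: `n = p₁ p₂ p₃`
      have hr1 : Ms.card = 1 := by omega
      have hs2 : Mb.card = 2 := by omega
      obtain ⟨p₁, hp₁⟩ := Multiset.card_eq_one.mp hr1
      obtain ⟨a, b, hab⟩ := Multiset.card_eq_two.mp hs2
      have hp₁Ms : p₁ ∈ Ms := by rw [hp₁]; exact Multiset.mem_singleton_self _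
      have haMb : a ∈ Mb := by rw [hab]; exact Multiset.mem_cons_self _ _
      have hbMb : b ∈ Mb := by rw [hab]; simp
      have hp₁M : p₁ ∈ M := Multiset.mem_of_mem_filter hp₁Ms
      have haM : a ∈ M := Multiset.mem_of_mem_filter haMb
      have hbM : b ∈ M := Multiset.mem_of_mem_filter hbMb
      have htriple : IsChenTriple z y n := by
        refine ⟨p₁, min a b, max a b, (hMmem _ hp₁M).1, ?_, ?_, hMz _ hp₁M,
          (Multiset.mem_filter.mp hp₁Ms).2, ?_, min_le_max, ?_⟩
        · rcases min_choice a b with h | h <;> rw [h]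
          exacts [(hMmem _ haM).1, (hMmem _ hbM).1]
        · rcases max_choice a b with h | h <;> rw [h]
          exacts [(hMmem _ haM).1, (hMmem _ hbM).1]
        · have ha := (Multiset.mem_filter.mp haMb).2
          have hb := (Multiset.mem_filter.mp hbMb).2
          rcases min_choice a b with h | h <;> rw [h] <;> omega
        · rw [mul_assoc, min_mul_max, hprod, hp₁, hab]
          simp
      rw [if_pos htriple]
      have : (1 : ℝ) = smallFactorCount z y n := by rw [← hMsCard, hr1]; norm_num
      linarith

/-- The pointwise inequality with the square term, valid for every `z`-rough `n ∈ A`: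
`1 − ½ r(n) − ½·1[triple] − 1[square] ≤ 1[Ω(n) ≤ 2]`. [cite: Nathanson1996, §10.2 (proof of Thm 10.2)] -/
theorem weight_le_indicator' {z y n : ℕ} (hn : n ≠ 0) (hny : n < y ^ 3) (hr : IsRough z n)
    [Decidable (IsChenTriple z y n)] [Decidable (HasPrimeSqFactor z y n)]
    [Decidable (Nat.IsAtMostAlmostPrime 2 n)] :
    (1 : ℝ) - (1 / 2) * smallFactorCount z y n - (1 / 2) * (if IsChenTriple z y n then 1 else 0) -
        (if HasPrimeSqFactor z y n then 1 else 0) ≤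
      if Nat.IsAtMostAlmostPrime 2 n then 1 else 0 := by
  by_cases hsq : HasPrimeSqFactor z y n
  · rw [if_pos hsq]
    have h0 : (0 : ℝ) ≤ smallFactorCount z y n := Nat.cast_nonneg _
    split_ifs <;> linarith
  · rw [if_neg hsq, sub_zero]
    exact weight_le_indicator hn hny hr hsq

/-! ### Summation -/

/-- For `n ≠ 0`, the prime factors of `n` in `[z, y)` are the primes `q ∈ [z, y)` dividing `n`.
[folklore] -/
theorem smallFactorCount_eq_card_filter_dvd {z y n : ℕ} (hn : n ≠ 0) :
    smallFactorCount z y n = #((primesIco z y).filter fun q => q ∣ n) := by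
  rw [smallFactorCount]
  congr 1
  ext q
  simp only [Finset.mem_filter, Nat.mem_primeFactors, mem_primesIco]
  tauto

/-- `∑_{n ∈ A, n rough} r(n) = ∑_{z ≤ q < y} S(A_q, z)` (interchange of summation).
[cite: Nathanson1996, §10.2 (proof of Thm 10.2)] -/
theorem sum_smallFactorCount_eq (hA : ∀ n ∈ A, n ≠ 0) :
    ∑ n ∈ A.filter (fun n => IsRough z n), (smallFactorCount z y n : ℝ) =
      ∑ q ∈ primesIco z y, (roughMultCount A z q : ℝ) := by
  have h1 : ∀ n ∈ A.filter (fun n => IsRough z n), (smallFactorCount z y n : ℝ) =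
      ∑ q ∈ primesIco z y, if q ∣ n then (1 : ℝ) else 0 := by
    intro n hn
    rw [smallFactorCount_eq_card_filter_dvd (hA n (Finset.mem_filter.mp hn).1),
      Finset.card_filter, Nat.cast_sum]
    refine Finset.sum_congr rfl fun q _ => ?_
    split_ifs <;> simp
  rw [Finset.sum_congr rfl h1, Finset.sum_comm]
  refine Finset.sum_congr rfl fun q _ => ?_
  rw [roughMultCount, Finset.card_filter, Nat.cast_sum, Finset.sum_filter]
  refine Finset.sum_congr rfl fun n _ => ?_
  by_cases h : IsRough z n <;> by_cases h' : q ∣ n <;> simp [h, h']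

/-- **The weighted-sieve inequality** (Nathanson, *Additive Number Theory*, Theorem 10.2, abstract
form; Chen 1973, (34)). Let `A` be a finite set of positive integers `< y³`. Then
`S(A, z) − ½ ∑_{z ≤ q < y, q prime} S(A_q, z) − ½ T(A; z, y) − E(A; z, y) ≤ #{n ∈ A : Ω(n) ≤ 2}`.
[cite: Nathanson1996, Thm 10.2] -/
theorem weightedSieve (hA : ∀ n ∈ A, n ≠ 0 ∧ n < y ^ 3) :
    (roughCount A z : ℝ) - (1 / 2) * ∑ q ∈ primesIco z y, (roughMultCount A z q : ℝ) -
        (1 / 2) * tripleCount A z y - squareCount A z y ≤ almostPrimeTwoCount A := by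
  classical
  set R := A.filter (fun n => IsRough z n) with hR
  have hA0 : ∀ n ∈ A, n ≠ 0 := fun n hn => (hA n hn).1
  -- sum the pointwise inequality over `R`
  have hsum : ∑ n ∈ R, ((1 : ℝ) - (1 / 2) * smallFactorCount z y n -
      (1 / 2) * (if IsChenTriple z y n then 1 else 0) - (if HasPrimeSqFactor z y n then 1 else 0)) ≤
      ∑ n ∈ R, (if Nat.IsAtMostAlmostPrime 2 n then (1 : ℝ) else 0) := by
    refine Finset.sum_le_sum fun n hn => ?_
    have hnA := (Finset.mem_filter.mp hn).1
    convert weight_le_indicator' (hA n hnA).1 (hA n hnA).2 (Finset.mem_filter.mp hn).2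
  -- evaluate both sides
  have hL : ∑ n ∈ R, ((1 : ℝ) - (1 / 2) * smallFactorCount z y n -
      (1 / 2) * (if IsChenTriple z y n then 1 else 0) - (if HasPrimeSqFactor z y n then 1 else 0)) =
      (roughCount A z : ℝ) - (1 / 2) * ∑ q ∈ primesIco z y, (roughMultCount A z q : ℝ) -
        (1 / 2) * #(R.filter fun n => IsChenTriple z y n) -
          #(R.filter fun n => HasPrimeSqFactor z y n) := by
    rw [Finset.sum_sub_distrib, Finset.sum_sub_distrib, Finset.sum_sub_distrib, ← Finset.mul_sum,
      ← Finset.mul_sum, sum_smallFactorCount_eq hA0, Finset.card_filter, Finset.card_filter,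
      Nat.cast_sum, Nat.cast_sum, Finset.sum_const, nsmul_eq_mul, mul_one, roughCount]
    simp only [Nat.cast_ite, Nat.cast_one, Nat.cast_zero]
    rfl
  have hRHS : ∑ n ∈ R, (if Nat.IsAtMostAlmostPrime 2 n then (1 : ℝ) else 0) =
      #(R.filter fun n => Nat.IsAtMostAlmostPrime 2 n) := by
    rw [Finset.card_filter, Nat.cast_sum]
    simp only [Nat.cast_ite, Nat.cast_one, Nat.cast_zero]
  rw [hL, hRHS] at hsum
  -- monotonicity in the three restricted counts
  have h1 : (#(R.filter fun n => IsChenTriple z y n) : ℝ) ≤ tripleCount A z y := by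
    rw [tripleCount]; exact_mod_cast Finset.card_le_card
      (Finset.monotone_filter_left _ (Finset.filter_subset _ A))
  have h2 : (#(R.filter fun n => HasPrimeSqFactor z y n) : ℝ) ≤ squareCount A z y := by
    rw [squareCount]; exact_mod_cast Finset.card_le_card
      (Finset.monotone_filter_left _ (Finset.filter_subset _ A))
  have h3 : (#(R.filter fun n => Nat.IsAtMostAlmostPrime 2 n) : ℝ) ≤ almostPrimeTwoCount A := by
    rw [almostPrimeTwoCount]; exact_mod_cast Finset.card_le_card
      (Finset.monotone_filter_left _ (Finset.filter_subset _ A))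
  linarith

/-! ### The error term `E(A; z, y) ≤ M/(z − 1)` -/

/-- `E(A; z, y) ≤ ∑_{z ≤ q < y, q prime} #{n ∈ A : q² ∣ n}`. [folklore] -/
theorem squareCount_le_sum :
    squareCount A z y ≤ ∑ q ∈ primesIco z y, #(A.filter fun n => q ^ 2 ∣ n) := by
  classical
  rw [squareCount]
  calc #(A.filter fun n => HasPrimeSqFactor z y n)
      ≤ #((primesIco z y).biUnion fun q => A.filter fun n => q ^ 2 ∣ n) := by
        refine Finset.card_le_card fun n hn => ?_
        rw [Finset.mem_filter] at hn
        obtain ⟨q, hq, hzq, hqy, hdvd⟩ := hn.2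
        exact Finset.mem_biUnion.mpr ⟨q, mem_primesIco.mpr ⟨hq, hzq, hqy⟩,
          Finset.mem_filter.mpr ⟨hn.1, hdvd⟩⟩
    _ ≤ ∑ q ∈ primesIco z y, #(A.filter fun n => q ^ 2 ∣ n) := Finset.card_biUnion_le

/-- `#{n ∈ A : d ∣ n} ≤ M / d` when `A ⊆ (0, M]`. [folklore] -/
theorem card_filter_dvd_le {M d : ℕ} (hAM : A ⊆ Finset.Ioc 0 M) :
    #(A.filter fun n => d ∣ n) ≤ M / d := by
  classical
  calc #(A.filter fun n => d ∣ n) ≤ #((Finset.Ioc 0 M).filter fun n => d ∣ n) :=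
        Finset.card_le_card (Finset.monotone_filter_left _ hAM)
    _ = M / d := Nat.Ioc_filter_dvd_card_eq_div M d

/-- `∑_{z ≤ q < y} 1/q² ≤ 1/(z − 1)` for `z ≥ 2` (comparison with the telescoping
`∑ 1/((q − 1) q) = 1/(z − 1) − 1/(y − 1)`). [folklore] -/
theorem sum_Ico_inv_sq_le {z y : ℕ} (hz : 2 ≤ z) :
    ∑ q ∈ Finset.Ico z y, (1 : ℝ) / (q : ℝ) ^ 2 ≤ 1 / ((z : ℝ) - 1) := by
  have key : ∀ y : ℕ, z ≤ y →
      ∑ q ∈ Finset.Ico z y, (1 : ℝ) / (q : ℝ) ^ 2 ≤ 1 / ((z : ℝ) - 1) - 1 / ((y : ℝ) - 1) := by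
    intro y hy
    induction y, hy using Nat.le_induction with
    | base => simp
    | succ m hm ih =>
      rw [Finset.sum_Ico_succ_top hm]
      have hm1 : (1 : ℝ) ≤ (m : ℝ) - 1 := by
        have : (2 : ℝ) ≤ m := by exact_mod_cast hz.trans hm
        linarith
      have hm0 : (0 : ℝ) < m := by linarith
      have hstep : 1 / (m : ℝ) ^ 2 ≤ 1 / ((m : ℝ) - 1) - 1 / (((m + 1 : ℕ) : ℝ) - 1) := by
        rw [Nat.cast_succ, add_sub_cancel_right, div_sub_div _ _ (by linarith) hm0.ne',
          div_le_div_iff₀ (by positivity) (mul_pos (by linarith) hm0)]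
        nlinarith
      linarith
  have hy1 : ∀ y : ℕ, z ≤ y → (0 : ℝ) ≤ 1 / ((y : ℝ) - 1) := fun y hy => by
    have : (2 : ℝ) ≤ y := by exact_mod_cast hz.trans hy
    exact div_nonneg zero_le_one (by linarith)
  by_cases hzy : z ≤ y
  · linarith [key y hzy, hy1 y hzy]
  · rw [Finset.Ico_eq_empty (by omega), Finset.sum_empty]
    exact hy1 z le_rfl

/-- **The error term**: if `A ⊆ (0, M]` and `z ≥ 2` then `E(A; z, y) ≤ M/(z − 1)`
(Nathanson p. 273: `N ∑_{z ≤ q < y} ∑_{k ≥ 2} (k − 1) q^{−k} < N/(z − 2) ≤ 2N/z`, here in the squarefree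
variant `∑_q M/q² ≤ M/(z − 1)`). [cite: Nathanson1996, §10.2 (proof of Thm 10.2)] -/
theorem squareCount_le {M : ℕ} (hAM : A ⊆ Finset.Ioc 0 M) (hz : 2 ≤ z) :
    (squareCount A z y : ℝ) ≤ M / ((z : ℝ) - 1) := by
  classical
  calc (squareCount A z y : ℝ) ≤ ∑ q ∈ primesIco z y, (#(A.filter fun n => q ^ 2 ∣ n) : ℝ) := by
        exact_mod_cast squareCount_le_sum
    _ ≤ ∑ q ∈ primesIco z y, (M : ℝ) * (1 / (q : ℝ) ^ 2) := by
        refine Finset.sum_le_sum fun q hq => ?_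
        have hq0 : (0 : ℝ) < (q : ℝ) ^ 2 := by
          have : (2 : ℝ) ≤ q := by exact_mod_cast (mem_primesIco.mp hq).1.two_le
          positivity
        rw [mul_one_div, le_div_iff₀ hq0]
        have h := card_filter_dvd_le (A := A) (d := q ^ 2) hAM
        have h' : ((M / q ^ 2 : ℕ) : ℝ) * ((q ^ 2 : ℕ) : ℝ) ≤ (M : ℝ) := by
          exact_mod_cast Nat.div_mul_le_self M (q ^ 2)
        calc (#(A.filter fun n => q ^ 2 ∣ n) : ℝ) * (q : ℝ) ^ 2
            ≤ ((M / q ^ 2 : ℕ) : ℝ) * (q : ℝ) ^ 2 :=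
              mul_le_mul_of_nonneg_right (by exact_mod_cast h) hq0.le
          _ = ((M / q ^ 2 : ℕ) : ℝ) * ((q ^ 2 : ℕ) : ℝ) := by rw [Nat.cast_pow]
          _ ≤ (M : ℝ) := h'
    _ ≤ ∑ q ∈ Finset.Ico z y, (M : ℝ) * (1 / (q : ℝ) ^ 2) := by
        refine Finset.sum_le_sum_of_subset_of_nonneg (Finset.filter_subset _ _) fun q _ _ => ?_
        positivity
    _ = M * ∑ q ∈ Finset.Ico z y, 1 / (q : ℝ) ^ 2 := by rw [Finset.mul_sum]
    _ ≤ M * (1 / ((z : ℝ) - 1)) := by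
        gcongr
        exact sum_Ico_inv_sq_le hz
    _ = M / ((z : ℝ) - 1) := mul_one_div _ _

/-- **The weighted-sieve inequality with the error term made explicit**: for `A ⊆ (0, M]` with
`M < y³` and `z ≥ 2`,
`S(A, z) − ½ ∑_{z ≤ q < y} S(A_q, z) − ½ T(A; z, y) − M/(z − 1) ≤ #{n ∈ A : Ω(n) ≤ 2}`
(Nathanson, Theorem 10.2, where `M = N`, `z = N^{1/8}`, and `T ≤ N^{1/3} + S(B, 𝒫, y)` is the
subsequent step). [cite: Nathanson1996, Thm 10.2] -/
theorem weightedSieve' {M : ℕ} (hAM : A ⊆ Finset.Ioc 0 M) (hMy : M < y ^ 3) (hz : 2 ≤ z) :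
    (roughCount A z : ℝ) - (1 / 2) * ∑ q ∈ primesIco z y, (roughMultCount A z q : ℝ) -
        (1 / 2) * tripleCount A z y - M / ((z : ℝ) - 1) ≤ almostPrimeTwoCount A := by
  have hA : ∀ n ∈ A, n ≠ 0 ∧ n < y ^ 3 := fun n hn => by
    have := Finset.mem_Ioc.mp (hAM hn)
    exact ⟨by omega, by omega⟩
  linarith [weightedSieve (A := A) (z := z) (y := y) hA, squareCount_le (A := A) (y := y) hAM hz]

end ChenSieve

end Literature.NumberTheory.Sieve
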